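import Literature.Barriers.QuantumAdvantage.AaronsonChenTableauStep
import Literature.Computability.QuantumComplexity.OracleWalk
import Literature.Computability.Complexity.ListBricks
import Literature.Computability.Complexity.FoldBricks
import Literature.Computability.Complexity.PlumbingBricks
import HarnessLib

/-!
# Instances, witnesses and their fields for the tableau threshold language (Aaronson–Chen, Lemma 5.3)

Machine-level support (`Literature/Barriers/QuantumAdvantage`, sequel of `AaronsonChenTableauStep.lean`
and `AaronsonChenTableau.lean`) for the `PSPACE^{TQBF}` simulation in the proof of Aaronson–Chen 2017,
Lemma 5.3 (CCC 2017, §5.3, pp. 22–23). The simulator's exact tests ("is `1/a ≤ W(S)`?",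
"is `j · W(S₂) < 2^m · W(S₁)`?") are memberships of INSTANCES

  `u = ⟨pad, ⟨gates, ⟨w₀, ⟨P₁, ⟨P₂, ⟨c₁, c₂⟩⟩⟩⟩⟩⟩`

(`pad` a unary yardstick, `gates` the coded annotated gate list `acGateCode`, `w₀` the initial
label, `P₁, P₂` cylinder patterns of labels, `c₁, c₂` signed coefficients) in a threshold language
`{u | 0 < Σ_Y [⟨u, Y⟩ ∈ Adm] (wp − wn)}` (`PSpaceSignedSum.lean`) whose witnesses `Y` carry a
selector bit `j`, a coefficient block `t`, a multiplicity block `ub`, copies of the two final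
states `f₁, f₂`, and the TABLEAU of the two walks (`AaronsonChenTableau.lean`). This file fixes
these string formats and the `FP` field extractors, with their values on well-formed strings:

* `patCode`, `coefCode`, `gasCode`, `encInst` (instances), `hdr`/`witOf` (the witness layout
  `j · t · ub · f₁ · f₂ · tab`, block lengths `1, L, L, N+3, N+3` with `L = |pad|`);
* extractors on `z = ⟨u, Y⟩`: `padZ … c2Z`, `jZ, tZ, ubZ, f1Z, f2Z, tabZ`, all in `FP`, and
  `fields_encInst` (their values);
* extractors on the elements `v = ⟨z, y⟩` of the universally quantified local languages (the
  offset `o = |y|` selects the item `ι = o/(N+5)` of the tableau, gate `i = ι/2`, walk `ι mod 2`):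
  `alignedT`, `gateV`, `parT`, `firstT`, `itemV`, `prevV`, `codeV`, `codeNextV`, the argument record
  `argV` fed to the one-gate check `stepChkT`, and their values on `mkV … Y y` (`*_mkV`: the
  `chkArg`-shaped record of the item against the state claimed by the previous item of the same
  walk, or the initial state);
* the one-bit checks built from them — `locT` (the LOCAL check: `stepChkT` on `argV`, plus "the
  last item claims the copied final state" `finEqT`), `gcondT`/`payV`/`aBitT` (the GUESS condition:
  an oracle gate with a `0`-side query `0p`, its payload `p`, the guess bit), `initT` — all in `FP`;
* the WEIGHTS `wpZ`, `wnZ ∈ FP` (unary, `≤ 1` symbol on every input: `length_wpZ_le`) and their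
  values `wpZ_mkZ`/`wnZ_mkZ = [coreOf …]`: final labels agree, lie in the selected cylinder
  (`patOK`), the coefficient block counts (`⟦t⟧ < n`), the phase class is accepted with the selected
  sign (`ADH.clsAcc`), and the multiplicity test `ADH.uTest (L-1)` passes (`OracleWalk.lean`).

## References

* S. Aaronson, L. Chen, CCC 2017, §5.3 (pp. 22–23) [AaronsonChen2017].
* S. Arora, B. Barak, *Computational Complexity: A Modern Approach*, CUP 2009, §4.1–4.2 (PSPACE,
  configuration/tableau checks), §1.3 (string plumbing) [AroraBarakCC2009].
-/

noncomputable section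

namespace Literature.Barriers.QuantumAdvantage

namespace AcTab

open _root_.Computability Polynomial Literature.Computability.Complexity Literature.Computability.Complexity.Brick
  Literature.Computability.Complexity.Plumb Literature.Computability.Cryptography Literature.Computability.QuantumComplexity
  Literature.Computability.QuantumComplexity.ADH

attribute [-simp] Brick.nthF_zero Brick.sndPow_zero

variable {N : ℕ}

/-! ### Codes of instances -/

/-- The code of a cylinder pattern: the coded list of `⟨1^{pos}, [val]⟩`. [folklore] -/
def patCode (P : List (ℕ × Bool)) : List Bool := encList (P.map fun e => boolPair (ones e.1) [e.2])

/-- The code of a signed coefficient `± n`: `⟨[σ], bin n⟩` (`σ = 1`: positive). [folklore] -/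
def coefCode (σ : Bool) (n : ℕ) : List Bool := boolPair [σ] (encodeNat n)

/-- The code of the gate data: the coded list of the annotated gate codes. [cite: AaronsonChen2017, §5.3 (p. 22)] -/
def gasCode (gts : List (QGate cliffordT N × List (List Bool))) : List Bool :=
  encList (gts.map fun gt => acGateCode gt.1 gt.2)

/-- The body `⟨gates, ⟨w₀, ⟨P₁, ⟨P₂, ⟨c₁, c₂⟩⟩⟩⟩⟩` of an instance. [folklore] -/
def encBody (gts : List (QGate cliffordT N × List (List Bool))) (w₀ : QReg N) (P₁ P₂ : List (ℕ × Bool))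
    (σ₁ : Bool) (n₁ : ℕ) (σ₂ : Bool) (n₂ : ℕ) : List Bool :=
  boolPair (gasCode gts) (boolPair (List.ofFn w₀) (boolPair (patCode P₁) (boolPair (patCode P₂)
    (boolPair (coefCode σ₁ n₁) (coefCode σ₂ n₂)))))

/-- **An instance** `⟨pad, body⟩`. [cite: AaronsonChen2017, §5.3 (pp. 22–23)] -/
def encInst (pad : List Bool) (gts : List (QGate cliffordT N × List (List Bool))) (w₀ : QReg N) (P₁ P₂ : List (ℕ × Bool))
    (σ₁ : Bool) (n₁ : ℕ) (σ₂ : Bool) (n₂ : ℕ) : List Bool :=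
  boolPair pad (encBody gts w₀ P₁ P₂ σ₁ n₁ σ₂ n₂)

/-! ### Field extractors on `z = ⟨u, Y⟩` -/

/-- `onesFn w = 1^{|w|}`. [folklore] -/
theorem onesFn_eq_ones (w : List Bool) : onesFn w = ones w.length := by
  rw [onesFn, unaryEncodeNat_eq_replicate]

/-- Field: the yardstick `pad`. [folklore] -/
def padZ : List Bool → List Bool := fstP ∘ fstP
/-- Field: the body. [folklore] -/
def bodyZ : List Bool → List Bool := sndP ∘ fstP
/-- Field: the gate codes. [folklore] -/
def gasZ : List Bool → List Bool := nthF 0 ∘ bodyZ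
/-- Field: the initial label. [folklore] -/
def w0Z : List Bool → List Bool := nthF 1 ∘ bodyZ
/-- Field: the first pattern. [folklore] -/
def p1Z : List Bool → List Bool := nthF 2 ∘ bodyZ
/-- Field: the second pattern. [folklore] -/
def p2Z : List Bool → List Bool := nthF 3 ∘ bodyZ
/-- Field: the first coefficient. [folklore] -/
def c1Z : List Bool → List Bool := nthF 4 ∘ bodyZ
/-- Field: the second coefficient. [folklore] -/
def c2Z : List Bool → List Bool := sndPow 4 ∘ bodyZ
/-- Field: the witness `Y`. [folklore] -/
def yZ : List Bool → List Bool := sndP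
/-- `1^L`, `L = |pad|`. [folklore] -/
def lZ : List Bool → List Bool := onesFn ∘ padZ
/-- `1^N`, `N = |w₀|`. [folklore] -/
def nZ : List Bool → List Bool := onesFn ∘ w0Z
/-- `1^{N+3}` (the width of a state code). [folklore] -/
def n3Z : List Bool → List Bool := OracleCompose.concatFn ∘ fanoutFn nZ (fun _ => ones 3)
/-- `1^{N+5}` (the width of an item). [folklore] -/
def wdZ : List Bool → List Bool := OracleCompose.concatFn ∘ fanoutFn nZ (fun _ => ones 5)
/-- The selector bit `j` (as a string of length `≤ 1`). [folklore] -/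
def jZ : List Bool → List Bool := take1Fn ∘ yZ
/-- `Y` after the selector. [folklore] -/
def y1Z : List Bool → List Bool := dropFn ∘ fanoutFn (fun _ => [true]) yZ
/-- The coefficient block `t` (`L` bits). [folklore] -/
def tZ : List Bool → List Bool := takeFn ∘ fanoutFn lZ y1Z
/-- `Y` after `t`. [folklore] -/
def y2Z : List Bool → List Bool := dropFn ∘ fanoutFn lZ y1Z
/-- The multiplicity block `ub` (`L` bits). [folklore] -/
def ubZ : List Bool → List Bool := takeFn ∘ fanoutFn lZ y2Z
/-- `Y` after `ub`. [folklore] -/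
def y3Z : List Bool → List Bool := dropFn ∘ fanoutFn lZ y2Z
/-- The copy of the first final state (`N + 3` bits). [folklore] -/
def f1Z : List Bool → List Bool := takeFn ∘ fanoutFn n3Z y3Z
/-- `Y` after `f₁`. [folklore] -/
def y4Z : List Bool → List Bool := dropFn ∘ fanoutFn n3Z y3Z
/-- The copy of the second final state. [folklore] -/
def f2Z : List Bool → List Bool := takeFn ∘ fanoutFn n3Z y4Z
/-- The tableau (and the free rest). [folklore] -/
def tabZ : List Bool → List Bool := dropFn ∘ fanoutFn n3Z y4Z

/-- The fields are in `FP`. [folklore] -/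
theorem padZ_mem_FP : padZ ∈ FP := comp_mem_FP fstP_mem_FP fstP_mem_FP
/-- The fields are in `FP`. [folklore] -/
theorem bodyZ_mem_FP : bodyZ ∈ FP := comp_mem_FP sndP_mem_FP fstP_mem_FP
/-- The fields are in `FP`. [folklore] -/
theorem gasZ_mem_FP : gasZ ∈ FP := comp_mem_FP (nthF_mem_FP 0) bodyZ_mem_FP
/-- The fields are in `FP`. [folklore] -/
theorem w0Z_mem_FP : w0Z ∈ FP := comp_mem_FP (nthF_mem_FP 1) bodyZ_mem_FP
/-- The fields are in `FP`. [folklore] -/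
theorem p1Z_mem_FP : p1Z ∈ FP := comp_mem_FP (nthF_mem_FP 2) bodyZ_mem_FP
/-- The fields are in `FP`. [folklore] -/
theorem p2Z_mem_FP : p2Z ∈ FP := comp_mem_FP (nthF_mem_FP 3) bodyZ_mem_FP
/-- The fields are in `FP`. [folklore] -/
theorem c1Z_mem_FP : c1Z ∈ FP := comp_mem_FP (nthF_mem_FP 4) bodyZ_mem_FP
/-- The fields are in `FP`. [folklore] -/
theorem c2Z_mem_FP : c2Z ∈ FP := comp_mem_FP (sndPow_mem_FP 4) bodyZ_mem_FP
/-- The fields are in `FP`. [folklore] -/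
theorem yZ_mem_FP : yZ ∈ FP := sndP_mem_FP
/-- The fields are in `FP`. [folklore] -/
theorem lZ_mem_FP : lZ ∈ FP := comp_mem_FP onesFn_mem_FP padZ_mem_FP
/-- The fields are in `FP`. [folklore] -/
theorem nZ_mem_FP : nZ ∈ FP := comp_mem_FP onesFn_mem_FP w0Z_mem_FP
/-- The fields are in `FP`. [folklore] -/
theorem n3Z_mem_FP : n3Z ∈ FP := comp_mem_FP OracleCompose.concatFn_mem_FP (fanoutFn_mem_FP nZ_mem_FP (const_mem_FP _))
/-- The fields are in `FP`. [folklore] -/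
theorem wdZ_mem_FP : wdZ ∈ FP := comp_mem_FP OracleCompose.concatFn_mem_FP (fanoutFn_mem_FP nZ_mem_FP (const_mem_FP _))
/-- The fields are in `FP`. [folklore] -/
theorem jZ_mem_FP : jZ ∈ FP := comp_mem_FP take1Fn_mem_FP yZ_mem_FP
/-- The fields are in `FP`. [folklore] -/
theorem y1Z_mem_FP : y1Z ∈ FP := comp_mem_FP dropFn_mem_FP (fanoutFn_mem_FP (const_mem_FP _) yZ_mem_FP)
/-- The fields are in `FP`. [folklore] -/
theorem tZ_mem_FP : tZ ∈ FP := comp_mem_FP takeFn_mem_FP (fanoutFn_mem_FP lZ_mem_FP y1Z_mem_FP)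
/-- The fields are in `FP`. [folklore] -/
theorem y2Z_mem_FP : y2Z ∈ FP := comp_mem_FP dropFn_mem_FP (fanoutFn_mem_FP lZ_mem_FP y1Z_mem_FP)
/-- The fields are in `FP`. [folklore] -/
theorem ubZ_mem_FP : ubZ ∈ FP := comp_mem_FP takeFn_mem_FP (fanoutFn_mem_FP lZ_mem_FP y2Z_mem_FP)
/-- The fields are in `FP`. [folklore] -/
theorem y3Z_mem_FP : y3Z ∈ FP := comp_mem_FP dropFn_mem_FP (fanoutFn_mem_FP lZ_mem_FP y2Z_mem_FP)
/-- The fields are in `FP`. [folklore] -/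
theorem f1Z_mem_FP : f1Z ∈ FP := comp_mem_FP takeFn_mem_FP (fanoutFn_mem_FP n3Z_mem_FP y3Z_mem_FP)
/-- The fields are in `FP`. [folklore] -/
theorem y4Z_mem_FP : y4Z ∈ FP := comp_mem_FP dropFn_mem_FP (fanoutFn_mem_FP n3Z_mem_FP y3Z_mem_FP)
/-- The fields are in `FP`. [folklore] -/
theorem f2Z_mem_FP : f2Z ∈ FP := comp_mem_FP takeFn_mem_FP (fanoutFn_mem_FP n3Z_mem_FP y4Z_mem_FP)
/-- The fields are in `FP`. [folklore] -/
theorem tabZ_mem_FP : tabZ ∈ FP := comp_mem_FP dropFn_mem_FP (fanoutFn_mem_FP n3Z_mem_FP y4Z_mem_FP)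

/-- The header length `1 + 2L + 2(N+3)` of a witness. [folklore] -/
def hdr (L N : ℕ) : ℕ := 1 + L + L + (N + 3) + (N + 3)

section Values

variable (pad : List Bool) (gts : List (QGate cliffordT N × List (List Bool))) (w₀ : QReg N) (P₁ P₂ : List (ℕ × Bool))
  (σ₁ : Bool) (n₁ : ℕ) (σ₂ : Bool) (n₂ : ℕ) (Y : List Bool)

/-- **Values of the instance fields.** [folklore] -/
theorem fields_encInst :
    let z := boolPair (encInst pad gts w₀ P₁ P₂ σ₁ n₁ σ₂ n₂) Y
    padZ z = pad ∧ gasZ z = gasCode gts ∧ w0Z z = List.ofFn w₀ ∧ p1Z z = patCode P₁ ∧ p2Z z = patCode P₂ ∧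
      c1Z z = coefCode σ₁ n₁ ∧ c2Z z = coefCode σ₂ n₂ ∧ yZ z = Y ∧ lZ z = ones pad.length ∧ nZ z = ones N ∧
      n3Z z = ones (N + 3) ∧ wdZ z = ones (N + 5) := by
  intro z
  have hb : bodyZ z = encBody gts w₀ P₁ P₂ σ₁ n₁ σ₂ n₂ := by simp [bodyZ, z, encInst]
  have hpad : padZ z = pad := by simp [padZ, z, encInst]
  have hw0 : w0Z z = List.ofFn w₀ := by simp [w0Z, hb, encBody]
  have hn : nZ z = ones N := by rw [nZ, Function.comp_apply, hw0, onesFn_eq_ones, List.length_ofFn]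
  refine ⟨hpad, by simp [gasZ, hb, encBody], hw0, by simp [p1Z, hb, encBody], by simp [p2Z, hb, encBody],
    by simp [c1Z, hb, encBody], by simp [c2Z, hb, encBody, Brick.sndPow_zero_boolPair], by simp [yZ, z], by rw [lZ, Function.comp_apply, hpad, onesFn_eq_ones],
    hn, ?_, ?_⟩
  · rw [n3Z, Function.comp_apply, fanoutFn_apply, hn, OracleCompose.concatFn_boolPair, ones, ones, ← List.replicate_add]
  · rw [wdZ, Function.comp_apply, fanoutFn_apply, hn, OracleCompose.concatFn_boolPair, ones, ones, ← List.replicate_add]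

/-- **Values of the witness fields.** [folklore] -/
theorem witness_fields :
    let z := boolPair (encInst pad gts w₀ P₁ P₂ σ₁ n₁ σ₂ n₂) Y
    let L := pad.length
    jZ z = Y.take 1 ∧ tZ z = (Y.drop 1).take L ∧ ubZ z = (Y.drop (1 + L)).take L ∧
      f1Z z = (Y.drop (1 + L + L)).take (N + 3) ∧ f2Z z = (Y.drop (1 + L + L + (N + 3))).take (N + 3) ∧
      tabZ z = Y.drop (hdr L N) := by
  intro z L
  obtain ⟨-, -, -, -, -, -, -, hy, hl, -, hn3, -⟩ := fields_encInst pad gts w₀ P₁ P₂ σ₁ n₁ σ₂ n₂ Y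
  have h1 : y1Z z = Y.drop 1 := by
    rw [y1Z, Function.comp_apply, fanoutFn_apply, hy, dropFn_boolPair, List.length_singleton]
  have h2 : y2Z z = Y.drop (1 + L) := by
    rw [y2Z, Function.comp_apply, fanoutFn_apply, hl, h1, dropFn_boolPair, length_ones, List.drop_drop]
  have h3 : y3Z z = Y.drop (1 + L + L) := by
    rw [y3Z, Function.comp_apply, fanoutFn_apply, hl, h2, dropFn_boolPair, length_ones, List.drop_drop]
  have h4 : y4Z z = Y.drop (1 + L + L + (N + 3)) := by
    rw [y4Z, Function.comp_apply, fanoutFn_apply, hn3, h3, dropFn_boolPair, length_ones, List.drop_drop]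
  refine ⟨by rw [jZ, Function.comp_apply, hy]; rfl, ?_, ?_, ?_, ?_, ?_⟩
  · rw [tZ, Function.comp_apply, fanoutFn_apply, hl, h1, takeFn_boolPair, length_ones]
  · rw [ubZ, Function.comp_apply, fanoutFn_apply, hl, h2, takeFn_boolPair, length_ones]
  · rw [f1Z, Function.comp_apply, fanoutFn_apply, hn3, h3, takeFn_boolPair, length_ones]
  · rw [f2Z, Function.comp_apply, fanoutFn_apply, hn3, h4, takeFn_boolPair, length_ones]
  · rw [tabZ, Function.comp_apply, fanoutFn_apply, hn3, h4, dropFn_boolPair, length_ones, List.drop_drop, hdr]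

end Values

/-! ### Extractors on the elements `v = ⟨z, y⟩` of the local languages -/

/-- The string `z` of `v = ⟨z, y⟩`. [folklore] -/
def zV : List Bool → List Bool := fstP
/-- The offset `1^o`, `o = |y|`. [folklore] -/
def oV : List Bool → List Bool := onesFn ∘ sndP
/-- `⟨1^{o / (N+5)}, 1^{o mod (N+5)}⟩`: item index and misalignment. [folklore] -/
def dmV : List Bool → List Bool := divModFn ∘ fanoutFn (wdZ ∘ zV) oV
/-- The item index `1^ι`. [folklore] -/
def idxV : List Bool → List Bool := fstF ∘ dmV
/-- "The offset is aligned to an item". [folklore] -/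
def alignedT : List Bool → List Bool := isNilFn ∘ sndF ∘ dmV
/-- `⟨1^{ι/2}, 1^{ι mod 2}⟩`: gate index and walk. [folklore] -/
def dm2V : List Bool → List Bool := divModFn ∘ fanoutFn (fun _ => ones 2) idxV
/-- The gate index `1^i`. [folklore] -/
def gateV : List Bool → List Bool := fstF ∘ dm2V
/-- "The item belongs to the second walk" (`ι` odd). [folklore] -/
def parT : List Bool → List Bool := notFn (isNilFn ∘ sndF ∘ dm2V)
/-- "The item belongs to the first gate" (`i = 0`). [folklore] -/
def firstT : List Bool → List Bool := isNilFn ∘ gateV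
/-- The code of gate `i` (yardstick `y`, of length `o ≥ i`). [folklore] -/
def codeV : List Bool → List Bool := nthLF ∘ fanoutFn sndP (fanoutFn (lenBinF ∘ gateV) (gasZ ∘ zV))
/-- The code of gate `i + 1` (empty iff `i` is the last gate or beyond). [folklore] -/
def codeNextV : List Bool → List Bool :=
  nthLF ∘ fanoutFn (List.cons true ∘ sndP) (fanoutFn (lenBinF ∘ List.cons true ∘ gateV) (gasZ ∘ zV))
/-- The item at offset `o` of the tableau. [folklore] -/
def itemV : List Bool → List Bool := takeFn ∘ fanoutFn (wdZ ∘ zV) (dropFn ∘ fanoutFn oV (tabZ ∘ zV))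
/-- `1^{o ∸ 2(N+5)}`: the offset of the previous item of the same walk. [folklore] -/
def backV : List Bool → List Bool := dropFn ∘ fanoutFn (OracleCompose.concatFn ∘ fanoutFn (wdZ ∘ zV) (wdZ ∘ zV)) oV
/-- The previous item of the same walk. [folklore] -/
def prevV : List Bool → List Bool := takeFn ∘ fanoutFn (wdZ ∘ zV) (dropFn ∘ fanoutFn backV (tabZ ∘ zV))
/-- The two leading bits `[c, a]` of an item. [folklore] -/
def caOf (it : List Bool → List Bool) : List Bool → List Bool := takeFn ∘ fanoutFn (fun _ => ones 2) it
/-- The label of an item (`N` bits from position `2`). [folklore] -/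
def labOf (it : List Bool → List Bool) : List Bool → List Bool :=
  takeFn ∘ fanoutFn (nZ ∘ zV) (dropFn ∘ fanoutFn (fun _ => ones 2) it)
/-- The phase of an item (the bits from position `N + 2`). [folklore] -/
def phOf (it : List Bool → List Bool) : List Bool → List Bool :=
  dropFn ∘ fanoutFn (OracleCompose.concatFn ∘ fanoutFn (nZ ∘ zV) (fun _ => ones 2)) it
/-- The label before the gate: the initial label at the first gate, else the previous item's. [folklore] -/
def prevLabV : List Bool → List Bool := iteFn firstT (w0Z ∘ zV) (labOf prevV)
/-- The phase before the gate: `000` at the first gate, else the previous item's. [folklore] -/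
def prevPhV : List Bool → List Bool := iteFn firstT (fun _ => [false, false, false]) (phOf prevV)
/-- **The argument record** `⟨code_i, ⟨[c, a], ⟨lab, ⟨ph, ⟨lab', ph'⟩⟩⟩⟩⟩` of the one-gate check
(`AaronsonChenTableauStep.chkArg`) for the item at offset `o`. [cite: AaronsonChen2017, §5.3 (pp. 22–23)] -/
def argV : List Bool → List Bool :=
  fanoutFn codeV (fanoutFn (caOf itemV) (fanoutFn prevLabV (fanoutFn prevPhV (fanoutFn (labOf itemV) (phOf itemV)))))

/-- The extractors are in `FP`. [folklore] -/
theorem zV_mem_FP : zV ∈ FP := fstP_mem_FP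
/-- The extractors are in `FP`. [folklore] -/
theorem oV_mem_FP : oV ∈ FP := comp_mem_FP onesFn_mem_FP sndP_mem_FP
/-- The extractors are in `FP`. [folklore] -/
theorem dmV_mem_FP : dmV ∈ FP := comp_mem_FP divModFn_mem_FP (fanoutFn_mem_FP (comp_mem_FP wdZ_mem_FP zV_mem_FP) oV_mem_FP)
/-- The extractors are in `FP`. [folklore] -/
theorem idxV_mem_FP : idxV ∈ FP := comp_mem_FP fstF_mem_FP dmV_mem_FP
/-- The extractors are in `FP`. [folklore] -/
theorem alignedT_mem_FP : alignedT ∈ FP := comp_mem_FP isNilFn_mem_FP (comp_mem_FP sndF_mem_FP dmV_mem_FP)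
/-- The extractors are in `FP`. [folklore] -/
theorem dm2V_mem_FP : dm2V ∈ FP := comp_mem_FP divModFn_mem_FP (fanoutFn_mem_FP (const_mem_FP _) idxV_mem_FP)
/-- The extractors are in `FP`. [folklore] -/
theorem gateV_mem_FP : gateV ∈ FP := comp_mem_FP fstF_mem_FP dm2V_mem_FP
/-- The extractors are in `FP`. [folklore] -/
theorem parT_mem_FP : parT ∈ FP := notFn_mem_FP (comp_mem_FP isNilFn_mem_FP (comp_mem_FP sndF_mem_FP dm2V_mem_FP))
/-- The extractors are in `FP`. [folklore] -/
theorem firstT_mem_FP : firstT ∈ FP := comp_mem_FP isNilFn_mem_FP gateV_mem_FP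
/-- The extractors are in `FP`. [folklore] -/
theorem codeV_mem_FP : codeV ∈ FP :=
  comp_mem_FP nthLF_mem_FP (fanoutFn_mem_FP sndP_mem_FP (fanoutFn_mem_FP (comp_mem_FP lenBinF_mem_FP gateV_mem_FP)
    (comp_mem_FP gasZ_mem_FP zV_mem_FP)))
/-- The extractors are in `FP`. [folklore] -/
theorem codeNextV_mem_FP : codeNextV ∈ FP :=
  comp_mem_FP nthLF_mem_FP (fanoutFn_mem_FP (comp_mem_FP (cons_mem_FP true) sndP_mem_FP)
    (fanoutFn_mem_FP (comp_mem_FP lenBinF_mem_FP (comp_mem_FP (cons_mem_FP true) gateV_mem_FP)) (comp_mem_FP gasZ_mem_FP zV_mem_FP)))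
/-- The extractors are in `FP`. [folklore] -/
theorem itemV_mem_FP : itemV ∈ FP :=
  comp_mem_FP takeFn_mem_FP (fanoutFn_mem_FP (comp_mem_FP wdZ_mem_FP zV_mem_FP)
    (comp_mem_FP dropFn_mem_FP (fanoutFn_mem_FP oV_mem_FP (comp_mem_FP tabZ_mem_FP zV_mem_FP))))
/-- The extractors are in `FP`. [folklore] -/
theorem backV_mem_FP : backV ∈ FP :=
  comp_mem_FP dropFn_mem_FP (fanoutFn_mem_FP (comp_mem_FP OracleCompose.concatFn_mem_FP
    (fanoutFn_mem_FP (comp_mem_FP wdZ_mem_FP zV_mem_FP) (comp_mem_FP wdZ_mem_FP zV_mem_FP))) oV_mem_FP)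
/-- The extractors are in `FP`. [folklore] -/
theorem prevV_mem_FP : prevV ∈ FP :=
  comp_mem_FP takeFn_mem_FP (fanoutFn_mem_FP (comp_mem_FP wdZ_mem_FP zV_mem_FP)
    (comp_mem_FP dropFn_mem_FP (fanoutFn_mem_FP backV_mem_FP (comp_mem_FP tabZ_mem_FP zV_mem_FP))))
/-- The extractors are in `FP`. [folklore] -/
theorem caOf_mem_FP {it : List Bool → List Bool} (h : it ∈ FP) : caOf it ∈ FP :=
  comp_mem_FP takeFn_mem_FP (fanoutFn_mem_FP (const_mem_FP _) h)
/-- The extractors are in `FP`. [folklore] -/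
theorem labOf_mem_FP {it : List Bool → List Bool} (h : it ∈ FP) : labOf it ∈ FP :=
  comp_mem_FP takeFn_mem_FP (fanoutFn_mem_FP (comp_mem_FP nZ_mem_FP zV_mem_FP)
    (comp_mem_FP dropFn_mem_FP (fanoutFn_mem_FP (const_mem_FP _) h)))
/-- The extractors are in `FP`. [folklore] -/
theorem phOf_mem_FP {it : List Bool → List Bool} (h : it ∈ FP) : phOf it ∈ FP :=
  comp_mem_FP dropFn_mem_FP (fanoutFn_mem_FP (comp_mem_FP OracleCompose.concatFn_mem_FP
    (fanoutFn_mem_FP (comp_mem_FP nZ_mem_FP zV_mem_FP) (const_mem_FP _))) h)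
/-- The extractors are in `FP`. [folklore] -/
theorem prevLabV_mem_FP : prevLabV ∈ FP := iteFn_mem_FP firstT_mem_FP (comp_mem_FP w0Z_mem_FP zV_mem_FP) (labOf_mem_FP prevV_mem_FP)
/-- The extractors are in `FP`. [folklore] -/
theorem prevPhV_mem_FP : prevPhV ∈ FP := iteFn_mem_FP firstT_mem_FP (const_mem_FP _) (phOf_mem_FP prevV_mem_FP)
/-- **`argV ∈ FP`.** [folklore] -/
theorem argV_mem_FP : argV ∈ FP :=
  fanoutFn_mem_FP codeV_mem_FP (fanoutFn_mem_FP (caOf_mem_FP itemV_mem_FP) (fanoutFn_mem_FP prevLabV_mem_FP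
    (fanoutFn_mem_FP prevPhV_mem_FP (fanoutFn_mem_FP (labOf_mem_FP itemV_mem_FP) (phOf_mem_FP itemV_mem_FP)))))

section ValuesV

variable (pad : List Bool) (gts : List (QGate cliffordT N × List (List Bool))) (w₀ : QReg N) (P₁ P₂ : List (ℕ × Bool))
  (σ₁ : Bool) (n₁ : ℕ) (σ₂ : Bool) (n₂ : ℕ) (Y y : List Bool)

/-- `isNilFn (ones n) = [n = 0]`. [folklore] -/
theorem isNilFn_ones (n : ℕ) : isNilFn (ones n) = [decide (n = 0)] := by
  cases n <;> simp [isNilFn, ones, List.replicate_succ]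

/-- The element `v = ⟨⟨u, Y⟩, y⟩` of a local language over a well-formed instance `u`. [folklore] -/
def mkV : List Bool := boolPair (boolPair (encInst pad gts w₀ P₁ P₂ σ₁ n₁ σ₂ n₂) Y) y

/-- The list of gate codes of the gate data. [folklore] -/
def codes : List (List Bool) := gts.map fun gt => acGateCode gt.1 gt.2

/-- Value of `zV`. [folklore] -/
theorem zV_mkV : zV (mkV pad gts w₀ P₁ P₂ σ₁ n₁ σ₂ n₂ Y y) = boolPair (encInst pad gts w₀ P₁ P₂ σ₁ n₁ σ₂ n₂) Y :=
  fstP_boolPair _ _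

/-- Value of `oV`. [folklore] -/
theorem oV_mkV : oV (mkV pad gts w₀ P₁ P₂ σ₁ n₁ σ₂ n₂ Y y) = ones y.length := by
  rw [oV, Function.comp_apply, mkV, sndP_boolPair, onesFn_eq_ones]

/-- Value of `dmV`. [folklore] -/
theorem dmV_mkV : dmV (mkV pad gts w₀ P₁ P₂ σ₁ n₁ σ₂ n₂ Y y) =
    boolPair (ones (y.length / (N + 5))) (ones (y.length % (N + 5))) := by
  obtain ⟨-, -, -, -, -, -, -, -, -, -, -, hwd⟩ := fields_encInst pad gts w₀ P₁ P₂ σ₁ n₁ σ₂ n₂ Y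
  rw [dmV, Function.comp_apply, fanoutFn_apply, Function.comp_apply, zV_mkV, hwd, oV_mkV, divModFn_boolPair]

/-- Value of `idxV`: the item index `ι = o / (N+5)`. [folklore] -/
theorem idxV_mkV : idxV (mkV pad gts w₀ P₁ P₂ σ₁ n₁ σ₂ n₂ Y y) = ones (y.length / (N + 5)) := by
  rw [idxV, Function.comp_apply, dmV_mkV, fstF_boolPair]

/-- Value of `alignedT`. [folklore] -/
theorem alignedT_mkV : alignedT (mkV pad gts w₀ P₁ P₂ σ₁ n₁ σ₂ n₂ Y y) = [decide (y.length % (N + 5) = 0)] := by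
  rw [alignedT, Function.comp_apply, Function.comp_apply, dmV_mkV, sndF_boolPair, isNilFn_ones]

/-- Value of `dm2V`. [folklore] -/
theorem dm2V_mkV : dm2V (mkV pad gts w₀ P₁ P₂ σ₁ n₁ σ₂ n₂ Y y) =
    boolPair (ones (y.length / (N + 5) / 2)) (ones (y.length / (N + 5) % 2)) := by
  rw [dm2V, Function.comp_apply, fanoutFn_apply, idxV_mkV, divModFn_boolPair]

/-- Value of `gateV`: the gate index `i = ι / 2`. [folklore] -/
theorem gateV_mkV : gateV (mkV pad gts w₀ P₁ P₂ σ₁ n₁ σ₂ n₂ Y y) = ones (y.length / (N + 5) / 2) := by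
  rw [gateV, Function.comp_apply, dm2V_mkV, fstF_boolPair]

/-- Value of `parT`: the walk of the item. [folklore] -/
theorem parT_mkV : parT (mkV pad gts w₀ P₁ P₂ σ₁ n₁ σ₂ n₂ Y y) = [decide (y.length / (N + 5) % 2 = 1)] := by
  have h : (isNilFn ∘ sndF ∘ dm2V) (mkV pad gts w₀ P₁ P₂ σ₁ n₁ σ₂ n₂ Y y) = [decide (y.length / (N + 5) % 2 = 0)] := by
    rw [Function.comp_apply, Function.comp_apply, dm2V_mkV, sndF_boolPair, isNilFn_ones]
  rw [parT, notFn_apply h]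
  rcases Nat.mod_two_eq_zero_or_one (y.length / (N + 5)) with h0 | h1
  · rw [h0]; rfl
  · rw [h1]; rfl

/-- Value of `firstT`. [folklore] -/
theorem firstT_mkV : firstT (mkV pad gts w₀ P₁ P₂ σ₁ n₁ σ₂ n₂ Y y) = [decide (y.length / (N + 5) / 2 = 0)] := by
  rw [firstT, Function.comp_apply, gateV_mkV, isNilFn_ones]

/-- Value of `codeV`: the code of gate `i`. [folklore] -/
theorem codeV_mkV : codeV (mkV pad gts w₀ P₁ P₂ σ₁ n₁ σ₂ n₂ Y y) = (codes gts).getD (y.length / (N + 5) / 2) [] := by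
  obtain ⟨-, hgas, -⟩ := fields_encInst pad gts w₀ P₁ P₂ σ₁ n₁ σ₂ n₂ Y
  have hio : y.length / (N + 5) / 2 ≤ y.length := (Nat.div_le_self _ _).trans (Nat.div_le_self _ _)
  rw [codeV, Function.comp_apply, fanoutFn_apply, fanoutFn_apply, Function.comp_apply, gateV_mkV, lenBinF_apply, length_ones,
    Function.comp_apply, zV_mkV, hgas, gasCode, mkV, sndP_boolPair, nthLF_apply y hio]
  rfl

/-- Value of `codeNextV`: the code of gate `i + 1`. [folklore] -/
theorem codeNextV_mkV : codeNextV (mkV pad gts w₀ P₁ P₂ σ₁ n₁ σ₂ n₂ Y y) = (codes gts).getD (y.length / (N + 5) / 2 + 1) [] := by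
  obtain ⟨-, hgas, -⟩ := fields_encInst pad gts w₀ P₁ P₂ σ₁ n₁ σ₂ n₂ Y
  have hio : y.length / (N + 5) / 2 + 1 ≤ (true :: y).length := by
    rw [List.length_cons]
    exact Nat.succ_le_succ ((Nat.div_le_self _ _).trans (Nat.div_le_self _ _))
  have hsnd : sndP (mkV pad gts w₀ P₁ P₂ σ₁ n₁ σ₂ n₂ Y y) = y := sndP_boolPair _ _
  simp only [codeNextV, Function.comp_apply, fanoutFn_apply, gateV_mkV, zV_mkV, hgas, gasCode, hsnd]
  rw [show lenBinF (true :: ones (y.length / (N + 5) / 2)) = encodeNat (y.length / (N + 5) / 2 + 1) by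
    rw [lenBinF_apply, List.length_cons, length_ones], nthLF_apply (true :: y) hio]
  rfl

/-- Value of `itemV`: the item at offset `o` of the tableau `Y ⇂ hdr`. [folklore] -/
theorem itemV_mkV : itemV (mkV pad gts w₀ P₁ P₂ σ₁ n₁ σ₂ n₂ Y y) = ((Y.drop (hdr pad.length N)).drop y.length).take (N + 5) := by
  obtain ⟨-, -, -, -, -, -, -, -, -, -, -, hwd⟩ := fields_encInst pad gts w₀ P₁ P₂ σ₁ n₁ σ₂ n₂ Y
  obtain ⟨-, -, -, -, -, htab⟩ := witness_fields pad gts w₀ P₁ P₂ σ₁ n₁ σ₂ n₂ Y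
  rw [itemV, Function.comp_apply, fanoutFn_apply, Function.comp_apply, zV_mkV, hwd, Function.comp_apply, fanoutFn_apply, oV_mkV,
    Function.comp_apply, zV_mkV, htab, dropFn_boolPair, length_ones, takeFn_boolPair, length_ones]

/-- Value of `backV`: `1^{o ∸ 2(N+5)}`. [folklore] -/
theorem backV_mkV : backV (mkV pad gts w₀ P₁ P₂ σ₁ n₁ σ₂ n₂ Y y) = ones (y.length - 2 * (N + 5)) := by
  obtain ⟨-, -, -, -, -, -, -, -, -, -, -, hwd⟩ := fields_encInst pad gts w₀ P₁ P₂ σ₁ n₁ σ₂ n₂ Y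
  rw [backV, Function.comp_apply, fanoutFn_apply, Function.comp_apply, fanoutFn_apply, Function.comp_apply, zV_mkV, hwd, oV_mkV,
    OracleCompose.concatFn_boolPair, dropFn_boolPair, List.length_append, length_ones, ones, ones, List.drop_replicate, two_mul]

/-- Value of `prevV`: the previous item of the same walk. [folklore] -/
theorem prevV_mkV : prevV (mkV pad gts w₀ P₁ P₂ σ₁ n₁ σ₂ n₂ Y y) =
    ((Y.drop (hdr pad.length N)).drop (y.length - 2 * (N + 5))).take (N + 5) := by
  obtain ⟨-, -, -, -, -, -, -, -, -, -, -, hwd⟩ := fields_encInst pad gts w₀ P₁ P₂ σ₁ n₁ σ₂ n₂ Y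
  obtain ⟨-, -, -, -, -, htab⟩ := witness_fields pad gts w₀ P₁ P₂ σ₁ n₁ σ₂ n₂ Y
  rw [prevV, Function.comp_apply, fanoutFn_apply, Function.comp_apply, zV_mkV, hwd, Function.comp_apply, fanoutFn_apply, backV_mkV,
    Function.comp_apply, zV_mkV, htab, dropFn_boolPair, length_ones, takeFn_boolPair, length_ones]

/-- Value of `caOf`. [folklore] -/
theorem caOf_mkV (it : List Bool → List Bool) :
    caOf it (mkV pad gts w₀ P₁ P₂ σ₁ n₁ σ₂ n₂ Y y) = (it (mkV pad gts w₀ P₁ P₂ σ₁ n₁ σ₂ n₂ Y y)).take 2 := by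
  rw [caOf, Function.comp_apply, fanoutFn_apply, takeFn_boolPair, length_ones]

/-- Value of `labOf`. [folklore] -/
theorem labOf_mkV (it : List Bool → List Bool) :
    labOf it (mkV pad gts w₀ P₁ P₂ σ₁ n₁ σ₂ n₂ Y y) = ((it (mkV pad gts w₀ P₁ P₂ σ₁ n₁ σ₂ n₂ Y y)).drop 2).take N := by
  obtain ⟨-, -, -, -, -, -, -, -, -, hn, -⟩ := fields_encInst pad gts w₀ P₁ P₂ σ₁ n₁ σ₂ n₂ Y
  rw [labOf, Function.comp_apply, fanoutFn_apply, Function.comp_apply, zV_mkV, hn, Function.comp_apply, fanoutFn_apply,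
    dropFn_boolPair, length_ones, takeFn_boolPair, length_ones]

/-- Value of `phOf`. [folklore] -/
theorem phOf_mkV (it : List Bool → List Bool) :
    phOf it (mkV pad gts w₀ P₁ P₂ σ₁ n₁ σ₂ n₂ Y y) = (it (mkV pad gts w₀ P₁ P₂ σ₁ n₁ σ₂ n₂ Y y)).drop (N + 2) := by
  obtain ⟨-, -, -, -, -, -, -, -, -, hn, -⟩ := fields_encInst pad gts w₀ P₁ P₂ σ₁ n₁ σ₂ n₂ Y
  rw [phOf, Function.comp_apply, fanoutFn_apply, Function.comp_apply, fanoutFn_apply, Function.comp_apply, zV_mkV, hn,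
    OracleCompose.concatFn_boolPair, dropFn_boolPair, List.length_append, length_ones, length_ones]

/-- Value of `prevLabV`. [folklore] -/
theorem prevLabV_mkV : prevLabV (mkV pad gts w₀ P₁ P₂ σ₁ n₁ σ₂ n₂ Y y) =
    if y.length / (N + 5) / 2 = 0 then List.ofFn w₀
    else ((prevV (mkV pad gts w₀ P₁ P₂ σ₁ n₁ σ₂ n₂ Y y)).drop 2).take N := by
  obtain ⟨-, -, hw0, -⟩ := fields_encInst pad gts w₀ P₁ P₂ σ₁ n₁ σ₂ n₂ Y
  rw [prevLabV, iteFn_apply (firstT_mkV pad gts w₀ P₁ P₂ σ₁ n₁ σ₂ n₂ Y y)]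
  by_cases h : y.length / (N + 5) / 2 = 0
  · rw [decide_eq_true h, if_pos h]
    simp only [if_true, Function.comp_apply, zV_mkV, hw0]
  · rw [decide_eq_false h, if_neg h]
    simp only [Bool.false_eq_true, if_false, labOf_mkV]

/-- Value of `prevPhV`. [folklore] -/
theorem prevPhV_mkV : prevPhV (mkV pad gts w₀ P₁ P₂ σ₁ n₁ σ₂ n₂ Y y) =
    if y.length / (N + 5) / 2 = 0 then [false, false, false]
    else (prevV (mkV pad gts w₀ P₁ P₂ σ₁ n₁ σ₂ n₂ Y y)).drop (N + 2) := by
  rw [prevPhV, iteFn_apply (firstT_mkV pad gts w₀ P₁ P₂ σ₁ n₁ σ₂ n₂ Y y)]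
  by_cases h : y.length / (N + 5) / 2 = 0
  · rw [decide_eq_true h, if_pos h]
    simp only [if_true]
  · rw [decide_eq_false h, if_neg h]
    simp only [Bool.false_eq_true, if_false, phOf_mkV]

/-- **Value of the argument record.** [cite: AaronsonChen2017, §5.3 (pp. 22–23)] -/
theorem argV_mkV : argV (mkV pad gts w₀ P₁ P₂ σ₁ n₁ σ₂ n₂ Y y) =
    let it := itemV (mkV pad gts w₀ P₁ P₂ σ₁ n₁ σ₂ n₂ Y y)
    boolPair ((codes gts).getD (y.length / (N + 5) / 2) [])
      (boolPair (it.take 2) (boolPair (prevLabV (mkV pad gts w₀ P₁ P₂ σ₁ n₁ σ₂ n₂ Y y))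
        (boolPair (prevPhV (mkV pad gts w₀ P₁ P₂ σ₁ n₁ σ₂ n₂ Y y)) (boolPair ((it.drop 2).take N) (it.drop (N + 2)))))) := by
  simp only [argV, fanoutFn_apply, codeV_mkV, caOf_mkV, labOf_mkV, phOf_mkV]

end ValuesV

/-! ### The local check, the guess condition, the initial-state check -/

/-- The copy of the final state of the item's walk. [folklore] -/
def finOfParV : List Bool → List Bool := iteFn parT (f2Z ∘ zV) (f1Z ∘ zV)
/-- "The item's claimed state is the copied final state of its walk". [folklore] -/
def finEqT : List Bool → List Bool := eqPairFn ∘ fanoutFn (dropFn ∘ fanoutFn (fun _ => ones 2) itemV) finOfParV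
/-- **The local check** at offset `o`: unaligned offsets and items beyond the gates pass; an item
of gate `i` must pass the one-gate check `stepChkT` against the previous state of its walk and,
at the last gate, claim the copied final state. [cite: AaronsonChen2017, §5.3 (pp. 22–23)] -/
def locT : List Bool → List Bool :=
  iteFn alignedT (iteFn (isNilFn ∘ codeV) (fun _ => [true])
    (andFn (stepChkT ∘ argV) (iteFn (isNilFn ∘ codeNextV) finEqT (fun _ => [true])))) (fun _ => [true])
/-- **The guess condition** at offset `o`: an aligned item of an ORACLE gate whose query (on the
previous label) is a `0`-side query `0p` — there the guess bit must be `[p ∈ TQBF]`. [cite: AaronsonChen2017, §5.3 (p. 22)] -/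
def gcondT : List Bool → List Bool :=
  andFn alignedT (andFn (notFn (isNilFn ∘ codeV)) (andFn (eqC [true] (take1Fn ∘ codeV)) (notFn (sideT ∘ argV))))
/-- The payload `p` of the query at offset `o`. [folklore] -/
def payV : List Bool → List Bool := payF ∘ argV
/-- The guess bit of the item at offset `o`, as a one-bit test. [folklore] -/
def aBitT : List Bool → List Bool := aT ∘ argV
/-- **The initial-state check** (needed only for the empty gate list): if there is no gate, both
copied final states are the initial state `w₀ 000`. [folklore] -/
def initT : List Bool → List Bool :=
  iteFn (isNilFn ∘ fstF ∘ gasZ) (andFn (eqPairFn ∘ fanoutFn f1Z (OracleCompose.concatFn ∘ fanoutFn w0Z (fun _ => [false, false, false])))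
    (eqPairFn ∘ fanoutFn f2Z (OracleCompose.concatFn ∘ fanoutFn w0Z (fun _ => [false, false, false])))) (fun _ => [true])

/-- `finOfParV ∈ FP`. [folklore] -/
theorem finOfParV_mem_FP : finOfParV ∈ FP :=
  iteFn_mem_FP parT_mem_FP (comp_mem_FP f2Z_mem_FP zV_mem_FP) (comp_mem_FP f1Z_mem_FP zV_mem_FP)
/-- `finEqT ∈ FP`. [folklore] -/
theorem finEqT_mem_FP : finEqT ∈ FP :=
  comp_mem_FP eqPairFn_mem_FP (fanoutFn_mem_FP (comp_mem_FP dropFn_mem_FP (fanoutFn_mem_FP (const_mem_FP _) itemV_mem_FP))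
    finOfParV_mem_FP)
/-- **`locT ∈ FP`.** [folklore] -/
theorem locT_mem_FP : locT ∈ FP :=
  iteFn_mem_FP alignedT_mem_FP (iteFn_mem_FP (comp_mem_FP isNilFn_mem_FP codeV_mem_FP) (const_mem_FP _)
    (andFn_mem_FP (comp_mem_FP stepChkT_mem_FP argV_mem_FP) (iteFn_mem_FP (comp_mem_FP isNilFn_mem_FP codeNextV_mem_FP)
      finEqT_mem_FP (const_mem_FP _)))) (const_mem_FP _)
/-- `gcondT ∈ FP`. [folklore] -/
theorem gcondT_mem_FP : gcondT ∈ FP :=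
  andFn_mem_FP alignedT_mem_FP (andFn_mem_FP (notFn_mem_FP (comp_mem_FP isNilFn_mem_FP codeV_mem_FP))
    (andFn_mem_FP (eqC_mem_FP _ (comp_mem_FP take1Fn_mem_FP codeV_mem_FP))
      (notFn_mem_FP (comp_mem_FP sideT_mem_FP argV_mem_FP))))
/-- `payV ∈ FP`. [folklore] -/
theorem payV_mem_FP : payV ∈ FP := comp_mem_FP payF_mem_FP argV_mem_FP
/-- `aBitT ∈ FP`. [folklore] -/
theorem aBitT_mem_FP : aBitT ∈ FP := comp_mem_FP aT_mem_FP argV_mem_FP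
/-- `initT ∈ FP`. [folklore] -/
theorem initT_mem_FP : initT ∈ FP :=
  iteFn_mem_FP (comp_mem_FP isNilFn_mem_FP (comp_mem_FP fstF_mem_FP gasZ_mem_FP))
    (andFn_mem_FP (comp_mem_FP eqPairFn_mem_FP (fanoutFn_mem_FP f1Z_mem_FP
      (comp_mem_FP OracleCompose.concatFn_mem_FP (fanoutFn_mem_FP w0Z_mem_FP (const_mem_FP _)))))
      (comp_mem_FP eqPairFn_mem_FP (fanoutFn_mem_FP f2Z_mem_FP
      (comp_mem_FP OracleCompose.concatFn_mem_FP (fanoutFn_mem_FP w0Z_mem_FP (const_mem_FP _))))))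
    (const_mem_FP _)

/-! ### The weights -/

/-- "The selector bit is `1`" (selects pattern/coefficient `2`). [folklore] -/
def jT : List Bool → List Bool := eqC [true] jZ
/-- The selected pattern. [folklore] -/
def patZ : List Bool → List Bool := iteFn jT p2Z p1Z
/-- The selected coefficient. [folklore] -/
def coefZ : List Bool → List Bool := iteFn jT c2Z c1Z
/-- "The selected coefficient is positive". [folklore] -/
def sgnT : List Bool → List Bool := eqC [true] (fstF ∘ coefZ)
/-- The absolute value of the selected coefficient (binary). [folklore] -/
def nF : List Bool → List Bool := sndF ∘ coefZ
/-- The copied final label of walk 1. [folklore] -/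
def lab1Z : List Bool → List Bool := takeFn ∘ fanoutFn nZ f1Z
/-- The copied final label of walk 2. [folklore] -/
def lab2Z : List Bool → List Bool := takeFn ∘ fanoutFn nZ f2Z
/-- The copied final phase of walk 1 (3 bits). [folklore] -/
def ph1Z : List Bool → List Bool := dropFn ∘ fanoutFn nZ f1Z
/-- The copied final phase of walk 2. [folklore] -/
def ph2Z : List Bool → List Bool := dropFn ∘ fanoutFn nZ f2Z
/-- "The two final labels agree". [folklore] -/
def labEqT : List Bool → List Bool := eqPairFn ∘ fanoutFn lab1Z lab2Z
/-- One pattern entry `⟨1^{pos}, [val]⟩` against a label: "bit `pos` of the label is `val`". [folklore] -/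
def bitEqT : List Bool → List Bool := eqPairFn ∘ fanoutFn (bitAtFn ∘ fanoutFn (fstF ∘ sndF) fstF) (sndF ∘ sndF)
/-- "The final label lies in the selected cylinder". [folklore] -/
def patOkT : List Bool → List Bool := allFn bitEqT ∘ fanoutFn lab1Z patZ
/-- "The coefficient block counts": `⟦t⟧ < n`. [folklore] -/
def ltT : List Bool → List Bool := ltFn ∘ fanoutFn tZ nF
/-- A 3-bit phase in unary. [folklore] -/
def phU (ph : List Bool → List Bool) : List Bool → List Bool := binToUnaryFn ∘ fanoutFn (fun _ => ones 7) ph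
/-- The class `(φ₁ + 7 φ₂) mod 8` of the pair of final phases, in unary. [cite: AdlemanDeMarraisHuang1997, §6 Lemma 6.10 (proof, step 5)] -/
def clsU : List Bool → List Bool :=
  modLenFn ∘ fanoutFn (fun _ => ones 8) (OracleCompose.concatFn ∘ fanoutFn (phU ph1Z) (rep7 (phU ph2Z)))
/-- "The class is `k`". [folklore] -/
def isClsT (k : ℕ) : List Bool → List Bool := eqC (ones k) clsU
/-- "The class is accepted with the sign of the selected coefficient" (`flip`: with the opposite sign). [cite: FortnowRogers1999JCSS, Lemma 3.2 (arXiv numbering)] -/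
def clsAccT (flip : Bool) : List Bool → List Bool :=
  iteFn (if flip then notFn sgnT else sgnT) (orFn (isClsT 0) (orFn (isClsT 1) (isClsT 7)))
    (orFn (isClsT 3) (orFn (isClsT 4) (isClsT 5)))
/-- "The class is odd". [folklore] -/
def oddT : List Bool → List Bool := orFn (isClsT 1) (orFn (isClsT 3) (orFn (isClsT 5) (isClsT 7)))
/-- The binary numeral of `2 · 4^{L-1} = 2^{2L-1}`: `0^{2L-1} 1` (`L ≥ 1`). [folklore] -/
def thrF : List Bool → List Bool :=
  OracleCompose.concatFn ∘ fanoutFn (List.tail ∘ OracleCompose.concatFn ∘ fanoutFn (Kannan.zerosFn ∘ padZ) (Kannan.zerosFn ∘ padZ))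
    (fun _ => [true])
/-- `(⟦ub⟧ + 1)²` in binary. [folklore] -/
def sqF : List Bool → List Bool :=
  prodFn ∘ fanoutFn (addFn ∘ fanoutFn ubZ (fun _ => [true])) (addFn ∘ fanoutFn ubZ (fun _ => [true]))
/-- **The multiplicity test** `uTest (L-1) d ub`: for an odd class `(⟦ub⟧ + 1)² ≤ 2·4^{L-1}`, for an
even class nothing (`|ub| = L`). [cite: FortnowRogers1999JCSS, Lemma 3.2 (arXiv numbering)] -/
def uT : List Bool → List Bool := iteFn oddT (notFn (ltFn ∘ fanoutFn thrF sqF)) (fun _ => [true])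
/-- The common one-bit core of the weights. [folklore] -/
def coreT (flip : Bool) : List Bool → List Bool := andFn labEqT (andFn patOkT (andFn ltT (andFn (clsAccT flip) uT)))
/-- **The positive weight** `wp` (unary, `≤ 1`). [cite: AaronsonChen2017, §5.3 (p. 23)] -/
def wpZ : List Bool → List Bool := iteFn (coreT false) (fun _ => [true]) (fun _ => [])
/-- **The negative weight** `wn` (unary, `≤ 1`). [cite: AaronsonChen2017, §5.3 (p. 23)] -/
def wnZ : List Bool → List Bool := iteFn (coreT true) (fun _ => [true]) (fun _ => [])

/-- `jT ∈ FP`. [folklore] -/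
theorem jT_mem_FP : jT ∈ FP := eqC_mem_FP _ jZ_mem_FP
/-- `patZ ∈ FP`. [folklore] -/
theorem patZ_mem_FP : patZ ∈ FP := iteFn_mem_FP jT_mem_FP p2Z_mem_FP p1Z_mem_FP
/-- `coefZ ∈ FP`. [folklore] -/
theorem coefZ_mem_FP : coefZ ∈ FP := iteFn_mem_FP jT_mem_FP c2Z_mem_FP c1Z_mem_FP
/-- `sgnT ∈ FP`. [folklore] -/
theorem sgnT_mem_FP : sgnT ∈ FP := eqC_mem_FP _ (comp_mem_FP fstF_mem_FP coefZ_mem_FP)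
/-- `nF ∈ FP`. [folklore] -/
theorem nF_mem_FP : nF ∈ FP := comp_mem_FP sndF_mem_FP coefZ_mem_FP
/-- `lab1Z ∈ FP`. [folklore] -/
theorem lab1Z_mem_FP : lab1Z ∈ FP := comp_mem_FP takeFn_mem_FP (fanoutFn_mem_FP nZ_mem_FP f1Z_mem_FP)
/-- `lab2Z ∈ FP`. [folklore] -/
theorem lab2Z_mem_FP : lab2Z ∈ FP := comp_mem_FP takeFn_mem_FP (fanoutFn_mem_FP nZ_mem_FP f2Z_mem_FP)
/-- `ph1Z ∈ FP`. [folklore] -/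
theorem ph1Z_mem_FP : ph1Z ∈ FP := comp_mem_FP dropFn_mem_FP (fanoutFn_mem_FP nZ_mem_FP f1Z_mem_FP)
/-- `ph2Z ∈ FP`. [folklore] -/
theorem ph2Z_mem_FP : ph2Z ∈ FP := comp_mem_FP dropFn_mem_FP (fanoutFn_mem_FP nZ_mem_FP f2Z_mem_FP)
/-- `labEqT ∈ FP`. [folklore] -/
theorem labEqT_mem_FP : labEqT ∈ FP := comp_mem_FP eqPairFn_mem_FP (fanoutFn_mem_FP lab1Z_mem_FP lab2Z_mem_FP)
/-- `bitEqT ∈ FP`. [folklore] -/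
theorem bitEqT_mem_FP : bitEqT ∈ FP :=
  comp_mem_FP eqPairFn_mem_FP (fanoutFn_mem_FP (comp_mem_FP bitAtFn_mem_FP (fanoutFn_mem_FP (comp_mem_FP fstF_mem_FP sndF_mem_FP)
    fstF_mem_FP)) (comp_mem_FP sndF_mem_FP sndF_mem_FP))
/-- `bitEqT` is one-bit. [folklore] -/
theorem oneBit_bitEqT : OneBit bitEqT := fun v => by
  unfold bitEqT
  rw [Function.comp_apply, fanoutFn_apply, eqPairFn_boolPair]
  exact ⟨_, rfl⟩
/-- `patOkT ∈ FP`. [folklore] -/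
theorem patOkT_mem_FP : patOkT ∈ FP := comp_mem_FP (allFn_mem_FP bitEqT_mem_FP oneBit_bitEqT) (fanoutFn_mem_FP lab1Z_mem_FP patZ_mem_FP)
/-- `ltT ∈ FP`. [folklore] -/
theorem ltT_mem_FP : ltT ∈ FP := comp_mem_FP ltFn_mem_FP (fanoutFn_mem_FP tZ_mem_FP nF_mem_FP)
/-- `phU ph ∈ FP`. [folklore] -/
theorem phU_mem_FP {ph : List Bool → List Bool} (h : ph ∈ FP) : phU ph ∈ FP :=
  comp_mem_FP binToUnaryFn_mem_FP (fanoutFn_mem_FP (const_mem_FP _) h)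
/-- `clsU ∈ FP`. [folklore] -/
theorem clsU_mem_FP : clsU ∈ FP :=
  comp_mem_FP modLenFn_mem_FP (fanoutFn_mem_FP (const_mem_FP _) (comp_mem_FP OracleCompose.concatFn_mem_FP
    (fanoutFn_mem_FP (phU_mem_FP ph1Z_mem_FP) (rep7_mem_FP (phU_mem_FP ph2Z_mem_FP)))))
/-- `isClsT k ∈ FP`. [folklore] -/
theorem isClsT_mem_FP (k : ℕ) : isClsT k ∈ FP := eqC_mem_FP _ clsU_mem_FP
/-- `clsAccT flip ∈ FP`. [folklore] -/
theorem clsAccT_mem_FP (flip : Bool) : clsAccT flip ∈ FP := by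
  unfold clsAccT
  refine iteFn_mem_FP ?_ (orFn_mem_FP (isClsT_mem_FP 0) (orFn_mem_FP (isClsT_mem_FP 1) (isClsT_mem_FP 7)))
    (orFn_mem_FP (isClsT_mem_FP 3) (orFn_mem_FP (isClsT_mem_FP 4) (isClsT_mem_FP 5)))
  cases flip
  · exact sgnT_mem_FP
  · exact notFn_mem_FP sgnT_mem_FP
/-- `oddT ∈ FP`. [folklore] -/
theorem oddT_mem_FP : oddT ∈ FP :=
  orFn_mem_FP (isClsT_mem_FP 1) (orFn_mem_FP (isClsT_mem_FP 3) (orFn_mem_FP (isClsT_mem_FP 5) (isClsT_mem_FP 7)))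
/-- `thrF ∈ FP`. [folklore] -/
theorem thrF_mem_FP : thrF ∈ FP :=
  comp_mem_FP OracleCompose.concatFn_mem_FP (fanoutFn_mem_FP (comp_mem_FP PRelSigma.tail_mem_FP
    (comp_mem_FP OracleCompose.concatFn_mem_FP (fanoutFn_mem_FP (comp_mem_FP Kannan.zerosFn_mem_FP padZ_mem_FP)
      (comp_mem_FP Kannan.zerosFn_mem_FP padZ_mem_FP)))) (const_mem_FP _))
/-- `sqF ∈ FP`. [folklore] -/
theorem sqF_mem_FP : sqF ∈ FP :=
  comp_mem_FP prodFn_mem_FP (fanoutFn_mem_FP (comp_mem_FP addFn_mem_FP (fanoutFn_mem_FP ubZ_mem_FP (const_mem_FP _)))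
    (comp_mem_FP addFn_mem_FP (fanoutFn_mem_FP ubZ_mem_FP (const_mem_FP _))))
/-- `uT ∈ FP`. [folklore] -/
theorem uT_mem_FP : uT ∈ FP :=
  iteFn_mem_FP oddT_mem_FP (notFn_mem_FP (comp_mem_FP ltFn_mem_FP (fanoutFn_mem_FP thrF_mem_FP sqF_mem_FP))) (const_mem_FP _)
/-- `coreT flip ∈ FP`. [folklore] -/
theorem coreT_mem_FP (flip : Bool) : coreT flip ∈ FP :=
  andFn_mem_FP labEqT_mem_FP (andFn_mem_FP patOkT_mem_FP (andFn_mem_FP ltT_mem_FP (andFn_mem_FP (clsAccT_mem_FP flip) uT_mem_FP)))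
/-- **`wpZ ∈ FP`.** [folklore] -/
theorem wpZ_mem_FP : wpZ ∈ FP := iteFn_mem_FP (coreT_mem_FP false) (const_mem_FP _) (const_mem_FP _)
/-- **`wnZ ∈ FP`.** [folklore] -/
theorem wnZ_mem_FP : wnZ ∈ FP := iteFn_mem_FP (coreT_mem_FP true) (const_mem_FP _) (const_mem_FP _)




/-! ### Values of the weights -/

section ValuesW

variable (pad : List Bool) (gts : List (QGate cliffordT N × List (List Bool))) (w₀ : QReg N) (P₁ P₂ : List (ℕ × Bool))
  (σ₁ : Bool) (n₁ : ℕ) (σ₂ : Bool) (n₂ : ℕ) (Y : List Bool)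

/-- The string `z = ⟨u, Y⟩` over a well-formed instance. [folklore] -/
def mkZ : List Bool := boolPair (encInst pad gts w₀ P₁ P₂ σ₁ n₁ σ₂ n₂) Y

/-- The selector bit read off `Y`. [folklore] -/
def selOf (Y : List Bool) : Bool := decide (Y.take 1 = [true])

/-- Value of `jT`. [folklore] -/
theorem jT_mkZ : jT (mkZ pad gts w₀ P₁ P₂ σ₁ n₁ σ₂ n₂ Y) = [selOf Y] := by
  obtain ⟨hj, -⟩ := witness_fields pad gts w₀ P₁ P₂ σ₁ n₁ σ₂ n₂ Y
  rw [jT, eqC_apply, mkZ, hj, selOf]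

/-- Value of `patZ`. [folklore] -/
theorem patZ_mkZ : patZ (mkZ pad gts w₀ P₁ P₂ σ₁ n₁ σ₂ n₂ Y) = patCode (if selOf Y then P₂ else P₁) := by
  obtain ⟨-, -, -, hp1, hp2, -⟩ := fields_encInst pad gts w₀ P₁ P₂ σ₁ n₁ σ₂ n₂ Y
  rw [patZ, iteFn_apply (jT_mkZ pad gts w₀ P₁ P₂ σ₁ n₁ σ₂ n₂ Y)]
  cases selOf Y
  · simpa [mkZ] using hp1
  · simpa [mkZ] using hp2

/-- Value of `coefZ`. [folklore] -/
theorem coefZ_mkZ : coefZ (mkZ pad gts w₀ P₁ P₂ σ₁ n₁ σ₂ n₂ Y) =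
    coefCode (if selOf Y then σ₂ else σ₁) (if selOf Y then n₂ else n₁) := by
  obtain ⟨-, -, -, -, -, hc1, hc2, -⟩ := fields_encInst pad gts w₀ P₁ P₂ σ₁ n₁ σ₂ n₂ Y
  rw [coefZ, iteFn_apply (jT_mkZ pad gts w₀ P₁ P₂ σ₁ n₁ σ₂ n₂ Y)]
  cases selOf Y
  · simpa [mkZ] using hc1
  · simpa [mkZ] using hc2

/-- Value of `sgnT`: the sign of the selected coefficient. [folklore] -/
theorem sgnT_mkZ : sgnT (mkZ pad gts w₀ P₁ P₂ σ₁ n₁ σ₂ n₂ Y) = [if selOf Y then σ₂ else σ₁] := by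
  rw [sgnT, eqC_apply, Function.comp_apply, coefZ_mkZ, coefCode, fstF_boolPair]
  cases (if selOf Y then σ₂ else σ₁) <;> rfl

/-- Value of `nF`: the absolute value of the selected coefficient. [folklore] -/
theorem nF_mkZ : nF (mkZ pad gts w₀ P₁ P₂ σ₁ n₁ σ₂ n₂ Y) = encodeNat (if selOf Y then n₂ else n₁) := by
  rw [nF, Function.comp_apply, coefZ_mkZ, coefCode, sndF_boolPair]

/-- The copied final states read off `Y`. [folklore] -/
def finOf (L N : ℕ) (Y : List Bool) (second : Bool) : List Bool :=
  (Y.drop (if second then 1 + L + L + (N + 3) else 1 + L + L)).take (N + 3)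

/-- Value of `f1Z`. [folklore] -/
theorem f1Z_mkZ : f1Z (mkZ pad gts w₀ P₁ P₂ σ₁ n₁ σ₂ n₂ Y) = finOf pad.length N Y false :=
  (witness_fields pad gts w₀ P₁ P₂ σ₁ n₁ σ₂ n₂ Y).2.2.2.1

/-- Value of `f2Z`. [folklore] -/
theorem f2Z_mkZ : f2Z (mkZ pad gts w₀ P₁ P₂ σ₁ n₁ σ₂ n₂ Y) = finOf pad.length N Y true :=
  (witness_fields pad gts w₀ P₁ P₂ σ₁ n₁ σ₂ n₂ Y).2.2.2.2.1

/-- Value of `nZ`. [folklore] -/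
theorem nZ_mkZ : nZ (mkZ pad gts w₀ P₁ P₂ σ₁ n₁ σ₂ n₂ Y) = ones N :=
  (fields_encInst pad gts w₀ P₁ P₂ σ₁ n₁ σ₂ n₂ Y).2.2.2.2.2.2.2.2.2.1

/-- Value of `lab1Z`. [folklore] -/
theorem lab1Z_mkZ : lab1Z (mkZ pad gts w₀ P₁ P₂ σ₁ n₁ σ₂ n₂ Y) = (finOf pad.length N Y false).take N := by
  rw [lab1Z, Function.comp_apply, fanoutFn_apply, nZ_mkZ, f1Z_mkZ, takeFn_boolPair, length_ones]

/-- Value of `lab2Z`. [folklore] -/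
theorem lab2Z_mkZ : lab2Z (mkZ pad gts w₀ P₁ P₂ σ₁ n₁ σ₂ n₂ Y) = (finOf pad.length N Y true).take N := by
  rw [lab2Z, Function.comp_apply, fanoutFn_apply, nZ_mkZ, f2Z_mkZ, takeFn_boolPair, length_ones]

/-- Value of `ph1Z`. [folklore] -/
theorem ph1Z_mkZ : ph1Z (mkZ pad gts w₀ P₁ P₂ σ₁ n₁ σ₂ n₂ Y) = (finOf pad.length N Y false).drop N := by
  rw [ph1Z, Function.comp_apply, fanoutFn_apply, nZ_mkZ, f1Z_mkZ, dropFn_boolPair, length_ones]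

/-- Value of `ph2Z`. [folklore] -/
theorem ph2Z_mkZ : ph2Z (mkZ pad gts w₀ P₁ P₂ σ₁ n₁ σ₂ n₂ Y) = (finOf pad.length N Y true).drop N := by
  rw [ph2Z, Function.comp_apply, fanoutFn_apply, nZ_mkZ, f2Z_mkZ, dropFn_boolPair, length_ones]

/-- Value of `labEqT`. [folklore] -/
theorem labEqT_mkZ : labEqT (mkZ pad gts w₀ P₁ P₂ σ₁ n₁ σ₂ n₂ Y) =
    [decide ((finOf pad.length N Y false).take N = (finOf pad.length N Y true).take N)] := by
  rw [labEqT, Function.comp_apply, fanoutFn_apply, lab1Z_mkZ, lab2Z_mkZ, eqPairFn_boolPair]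

/-- Value of `bitEqT` on a label and a pattern entry. [folklore] -/
theorem bitEqT_entry (lab : List Bool) (e : ℕ × Bool) :
    bitEqT (boolPair lab (boolPair (ones e.1) [e.2])) = [decide ((lab.drop e.1).take 1 = [e.2])] := by
  rw [bitEqT, Function.comp_apply, fanoutFn_apply, Function.comp_apply, fanoutFn_apply, Function.comp_apply, sndF_boolPair,
    fstF_boolPair, fstF_boolPair, bitAtFn_boolPair, length_ones, Function.comp_apply, sndF_boolPair, sndF_boolPair, eqPairFn_boolPair]

/-- A label string satisfies a cylinder pattern (Boolean). [folklore] -/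
def patOK (P : List (ℕ × Bool)) (lab : List Bool) : Bool := P.all fun e => decide ((lab.drop e.1).take 1 = [e.2])

/-- Value of `patOkT`: the final label lies in the selected cylinder. [folklore] -/
theorem patOkT_mkZ : patOkT (mkZ pad gts w₀ P₁ P₂ σ₁ n₁ σ₂ n₂ Y) =
    [patOK (if selOf Y then P₂ else P₁) ((finOf pad.length N Y false).take N)] := by
  rw [patOkT, Function.comp_apply, fanoutFn_apply, lab1Z_mkZ, patZ_mkZ, patCode, allFn_boolPair oneBit_bitEqT, decNil_encList]
  congr 1
  rw [patOK, Bool.eq_iff_iff, decide_eq_true_iff, List.all_eq_true]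
  simp only [List.forall_mem_map, bitEqT_entry, List.cons.injEq, and_true, decide_eq_true_iff]

/-- The coefficient block read off `Y`. [folklore] -/
def tOf (L : ℕ) (Y : List Bool) : List Bool := (Y.drop 1).take L

/-- The multiplicity block read off `Y`. [folklore] -/
def ubOf (L : ℕ) (Y : List Bool) : List Bool := (Y.drop (1 + L)).take L

/-- Value of `ltT`: `⟦t⟧ < n`. [folklore] -/
theorem ltT_mkZ : ltT (mkZ pad gts w₀ P₁ P₂ σ₁ n₁ σ₂ n₂ Y) =
    [decide (bitsToNat (tOf pad.length Y) < if selOf Y then n₂ else n₁)] := by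
  obtain ⟨-, ht, -⟩ := witness_fields pad gts w₀ P₁ P₂ σ₁ n₁ σ₂ n₂ Y
  rw [ltT, Function.comp_apply, fanoutFn_apply, nF_mkZ, mkZ, ht, ltFn_boolPair, bitsToNat_encodeNat, tOf]

/-- The phases read off the copied final states. [folklore] -/
def phOfFin (L N : ℕ) (Y : List Bool) (second : Bool) : ℕ := bitsToNat ((finOf L N Y second).drop N)

/-- A copied phase is below `8`. [folklore] -/
theorem phOfFin_lt (L N : ℕ) (Y : List Bool) (second : Bool) : phOfFin L N Y second < 8 := by
  unfold phOfFin
  have h := bitsToNat_lt ((finOf L N Y second).drop N)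
  have hl : ((finOf L N Y second).drop N).length ≤ 3 := by
    rw [List.length_drop, finOf, List.length_take]; omega
  calc _ < 2 ^ ((finOf L N Y second).drop N).length := h
    _ ≤ 2 ^ 3 := Nat.pow_le_pow_right (by norm_num) hl

/-- Value of `phU ph1Z`. [folklore] -/
theorem phU_ph1Z_mkZ : phU ph1Z (mkZ pad gts w₀ P₁ P₂ σ₁ n₁ σ₂ n₂ Y) = ones (phOfFin pad.length N Y false) := by
  rw [phU, Function.comp_apply, fanoutFn_apply, ph1Z_mkZ, binToUnaryFn_boolPair, length_ones, phOfFin,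
    min_eq_left (by have := phOfFin_lt pad.length N Y false; unfold phOfFin at this; omega)]

/-- Value of `phU ph2Z`. [folklore] -/
theorem phU_ph2Z_mkZ : phU ph2Z (mkZ pad gts w₀ P₁ P₂ σ₁ n₁ σ₂ n₂ Y) = ones (phOfFin pad.length N Y true) := by
  rw [phU, Function.comp_apply, fanoutFn_apply, ph2Z_mkZ, binToUnaryFn_boolPair, length_ones, phOfFin,
    min_eq_left (by have := phOfFin_lt pad.length N Y true; unfold phOfFin at this; omega)]

/-- `rep7` of a unary field. [folklore] -/
theorem rep7_ones {f : List Bool → List Bool} {v : List Bool} {m : ℕ} (h : f v = ones m) : rep7 f v = ones (7 * m) := by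
  simp only [rep7, Function.comp_apply, fanoutFn_apply, OracleCompose.concatFn_boolPair, h, ones, ← List.replicate_add]
  congr 1
  ring

/-- The class of the copied final phases. [folklore] -/
def clsOfFin (L N : ℕ) (Y : List Bool) : ℕ := (phOfFin L N Y false + 7 * phOfFin L N Y true) % 8

/-- Value of `clsU`: the class in unary. [cite: AdlemanDeMarraisHuang1997, §6 Lemma 6.10 (proof, step 5)] -/
theorem clsU_mkZ : clsU (mkZ pad gts w₀ P₁ P₂ σ₁ n₁ σ₂ n₂ Y) = ones (clsOfFin pad.length N Y) := by
  rw [clsU, Function.comp_apply, fanoutFn_apply, Function.comp_apply, fanoutFn_apply, phU_ph1Z_mkZ,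
    rep7_ones (phU_ph2Z_mkZ pad gts w₀ P₁ P₂ σ₁ n₁ σ₂ n₂ Y), OracleCompose.concatFn_boolPair, modLenFn_boolPair,
    List.length_append, length_ones, length_ones, clsOfFin]

/-- Value of `isClsT k`. [folklore] -/
theorem isClsT_mkZ (k : ℕ) : isClsT k (mkZ pad gts w₀ P₁ P₂ σ₁ n₁ σ₂ n₂ Y) = [decide (clsOfFin pad.length N Y = k)] := by
  rw [isClsT, eqC_apply, clsU_mkZ]
  simp only [ones_inj]

/-- Value of `clsAccT flip`: the accepted classes for the (possibly flipped) sign of the selected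
coefficient. [cite: FortnowRogers1999JCSS, Lemma 3.2 (arXiv numbering)] -/
theorem clsAccT_mkZ (flip : Bool) : clsAccT flip (mkZ pad gts w₀ P₁ P₂ σ₁ n₁ σ₂ n₂ Y) =
    [clsAcc ((if selOf Y then σ₂ else σ₁) ^^ flip) (clsOfFin pad.length N Y)] := by
  have hsel : (if flip then notFn sgnT else sgnT) (mkZ pad gts w₀ P₁ P₂ σ₁ n₁ σ₂ n₂ Y) = [(if selOf Y then σ₂ else σ₁) ^^ flip] := by
    cases flip
    · rw [if_neg Bool.false_ne_true, sgnT_mkZ, Bool.xor_false]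
    · rw [if_pos rfl, notFn_apply (sgnT_mkZ pad gts w₀ P₁ P₂ σ₁ n₁ σ₂ n₂ Y), Bool.xor_true]
  have hpos := orFn_apply (isClsT_mkZ pad gts w₀ P₁ P₂ σ₁ n₁ σ₂ n₂ Y 0) (orFn_apply (isClsT_mkZ pad gts w₀ P₁ P₂ σ₁ n₁ σ₂ n₂ Y 1)
    (isClsT_mkZ pad gts w₀ P₁ P₂ σ₁ n₁ σ₂ n₂ Y 7))
  have hneg := orFn_apply (isClsT_mkZ pad gts w₀ P₁ P₂ σ₁ n₁ σ₂ n₂ Y 3) (orFn_apply (isClsT_mkZ pad gts w₀ P₁ P₂ σ₁ n₁ σ₂ n₂ Y 4)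
    (isClsT_mkZ pad gts w₀ P₁ P₂ σ₁ n₁ σ₂ n₂ Y 5))
  rw [clsAccT, iteFn_apply hsel, clsAcc]
  cases ((if selOf Y then σ₂ else σ₁) ^^ flip)
  · simp only [Bool.false_eq_true, if_false, hneg, Bool.decide_or]
  · simp only [if_true, hpos, Bool.decide_or]

/-- Value of `oddT`: the class is odd. [folklore] -/
theorem oddT_mkZ : oddT (mkZ pad gts w₀ P₁ P₂ σ₁ n₁ σ₂ n₂ Y) = [decide (clsOfFin pad.length N Y % 2 = 1)] := by
  rw [oddT, orFn_apply (isClsT_mkZ pad gts w₀ P₁ P₂ σ₁ n₁ σ₂ n₂ Y 1) (orFn_apply (isClsT_mkZ pad gts w₀ P₁ P₂ σ₁ n₁ σ₂ n₂ Y 3)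
    (orFn_apply (isClsT_mkZ pad gts w₀ P₁ P₂ σ₁ n₁ σ₂ n₂ Y 5) (isClsT_mkZ pad gts w₀ P₁ P₂ σ₁ n₁ σ₂ n₂ Y 7)))]
  have h8 : clsOfFin pad.length N Y < 8 := Nat.mod_lt _ (by norm_num)
  generalize clsOfFin pad.length N Y = D at h8 ⊢
  interval_cases D <;> decide

/-- Value of `thrF`: the numeral of `2 · 4^{L-1}` (`L ≥ 1`). [folklore] -/
theorem bitsToNat_thrF_mkZ (hL : 1 ≤ pad.length) : bitsToNat (thrF (mkZ pad gts w₀ P₁ P₂ σ₁ n₁ σ₂ n₂ Y)) = 2 * 4 ^ (pad.length - 1) := by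
  obtain ⟨hpad, -⟩ := fields_encInst pad gts w₀ P₁ P₂ σ₁ n₁ σ₂ n₂ Y
  have hz : thrF (mkZ pad gts w₀ P₁ P₂ σ₁ n₁ σ₂ n₂ Y) = List.replicate (2 * pad.length - 1) false ++ [true] := by
    simp only [thrF, Function.comp_apply, fanoutFn_apply, mkZ, hpad, Kannan.zerosFn_apply, OracleCompose.concatFn_boolPair,
      ← List.replicate_add]
    rw [show pad.length + pad.length = (2 * pad.length - 1) + 1 by omega, List.replicate_succ, List.tail_cons]
  rw [hz, bitsToNat_append, bitsToNat_replicate_false, List.length_replicate, zero_add, bitsToNat_cons, bitsToNat_nil]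
  simp only [Bool.toNat_true, mul_zero, add_zero, mul_one]
  rw [show 2 * pad.length - 1 = 2 * (pad.length - 1) + 1 by omega, pow_succ, pow_mul]
  norm_num
  ring

/-- Value of `sqF`: `(⟦ub⟧ + 1)²`. [folklore] -/
theorem sqF_mkZ : sqF (mkZ pad gts w₀ P₁ P₂ σ₁ n₁ σ₂ n₂ Y) =
    encodeNat ((bitsToNat (ubOf pad.length Y) + 1) * (bitsToNat (ubOf pad.length Y) + 1)) := by
  obtain ⟨-, -, hub, -⟩ := witness_fields pad gts w₀ P₁ P₂ σ₁ n₁ σ₂ n₂ Y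
  have hu : ubZ (mkZ pad gts w₀ P₁ P₂ σ₁ n₁ σ₂ n₂ Y) = ubOf pad.length Y := hub
  simp only [sqF, Function.comp_apply, fanoutFn_apply, hu, addFn_boolPair, bitsToNat_cons, bitsToNat_nil, Bool.toNat_true,
    prodFn_boolPair, bitsToNat_encodeNat]

/-- Value of `uT`: the multiplicity test `uTest (L-1) d ub` (`L ≥ 1`, `|ub| = L`). [cite: FortnowRogers1999JCSS, Lemma 3.2 (arXiv numbering)] -/
theorem uT_mkZ (hL : 1 ≤ pad.length) (hY : 1 + pad.length + pad.length ≤ Y.length) :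
    uT (mkZ pad gts w₀ P₁ P₂ σ₁ n₁ σ₂ n₂ Y) = [uTest (pad.length - 1) (clsOfFin pad.length N Y) (ubOf pad.length Y)] := by
  have hodd : (notFn (ltFn ∘ fanoutFn thrF sqF)) (mkZ pad gts w₀ P₁ P₂ σ₁ n₁ σ₂ n₂ Y) =
      [decide ((bitsToNat (ubOf pad.length Y) + 1) * (bitsToNat (ubOf pad.length Y) + 1) ≤ 2 * 4 ^ (pad.length - 1))] := by
    rw [notFn_apply (show (ltFn ∘ fanoutFn thrF sqF) (mkZ pad gts w₀ P₁ P₂ σ₁ n₁ σ₂ n₂ Y) = _ by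
      rw [Function.comp_apply, fanoutFn_apply, ltFn_boolPair, bitsToNat_thrF_mkZ pad gts w₀ P₁ P₂ σ₁ n₁ σ₂ n₂ Y hL, sqF_mkZ,
        bitsToNat_encodeNat])]
    simp only [← decide_not, not_lt]
  have hlen : (ubOf pad.length Y).length = pad.length := by
    rw [ubOf, List.length_take, List.length_drop]; omega
  rw [uT, iteFn_apply (oddT_mkZ pad gts w₀ P₁ P₂ σ₁ n₁ σ₂ n₂ Y), uTest]
  by_cases ho : clsOfFin pad.length N Y % 2 = 1
  · rw [decide_eq_true ho, if_pos rfl, if_pos ho, hodd]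
  · rw [decide_eq_false ho, if_neg Bool.false_ne_true, if_neg ho, Nat.sub_add_cancel hL,
      List.drop_of_length_le hlen.le]
    simp

/-- **The core condition** of the weights, read off `Y`. [cite: AaronsonChen2017, §5.3 (p. 23)] -/
def coreOf (L N : ℕ) (P₁ P₂ : List (ℕ × Bool)) (σ₁ : Bool) (n₁ : ℕ) (σ₂ : Bool) (n₂ : ℕ) (flip : Bool) (Y : List Bool) : Bool :=
  decide ((finOf L N Y false).take N = (finOf L N Y true).take N) &&
    (patOK (if selOf Y then P₂ else P₁) ((finOf L N Y false).take N) &&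
      (decide (bitsToNat (tOf L Y) < if selOf Y then n₂ else n₁) &&
        (clsAcc ((if selOf Y then σ₂ else σ₁) ^^ flip) (clsOfFin L N Y) && uTest (L - 1) (clsOfFin L N Y) (ubOf L Y))))

/-- Value of `coreT flip`. [folklore] -/
theorem coreT_mkZ (flip : Bool) (hL : 1 ≤ pad.length) (hY : 1 + pad.length + pad.length ≤ Y.length) :
    coreT flip (mkZ pad gts w₀ P₁ P₂ σ₁ n₁ σ₂ n₂ Y) = [coreOf pad.length N P₁ P₂ σ₁ n₁ σ₂ n₂ flip Y] := by
  rw [coreT, andFn_apply (labEqT_mkZ pad gts w₀ P₁ P₂ σ₁ n₁ σ₂ n₂ Y) (andFn_apply (patOkT_mkZ pad gts w₀ P₁ P₂ σ₁ n₁ σ₂ n₂ Y)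
    (andFn_apply (ltT_mkZ pad gts w₀ P₁ P₂ σ₁ n₁ σ₂ n₂ Y) (andFn_apply (clsAccT_mkZ pad gts w₀ P₁ P₂ σ₁ n₁ σ₂ n₂ Y flip)
    (uT_mkZ pad gts w₀ P₁ P₂ σ₁ n₁ σ₂ n₂ Y hL hY)))), coreOf]

/-- **Value of the positive weight**: `[1]` or `ε`. [cite: AaronsonChen2017, §5.3 (p. 23)] -/
theorem wpZ_mkZ (hL : 1 ≤ pad.length) (hY : 1 + pad.length + pad.length ≤ Y.length) :
    wpZ (mkZ pad gts w₀ P₁ P₂ σ₁ n₁ σ₂ n₂ Y) = if coreOf pad.length N P₁ P₂ σ₁ n₁ σ₂ n₂ false Y then [true] else [] := by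
  rw [wpZ, iteFn_apply (coreT_mkZ pad gts w₀ P₁ P₂ σ₁ n₁ σ₂ n₂ Y false hL hY)]

/-- **Value of the negative weight**: `[1]` or `ε`. [cite: AaronsonChen2017, §5.3 (p. 23)] -/
theorem wnZ_mkZ (hL : 1 ≤ pad.length) (hY : 1 + pad.length + pad.length ≤ Y.length) :
    wnZ (mkZ pad gts w₀ P₁ P₂ σ₁ n₁ σ₂ n₂ Y) = if coreOf pad.length N P₁ P₂ σ₁ n₁ σ₂ n₂ true Y then [true] else [] := by
  rw [wnZ, iteFn_apply (coreT_mkZ pad gts w₀ P₁ P₂ σ₁ n₁ σ₂ n₂ Y true hL hY)]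

/-- `eqC w f` is one-bit. [folklore] -/
theorem oneBit_eqC (w : List Bool) (f : List Bool → List Bool) : OneBit (eqC w f) := fun z => ⟨_, eqC_apply w f z⟩

/-- `coreT flip` is one-bit on every input. [folklore] -/
theorem oneBit_coreT (flip : Bool) : OneBit (coreT flip) := by
  refine oneBit_andFn (oneBit_eqPairFn'.comp _) (oneBit_andFn ((oneBit_allFn oneBit_bitEqT).comp _)
    (oneBit_andFn (oneBit_ltFn.comp _) (oneBit_andFn ?_ ?_)))
  · unfold clsAccT
    refine OneBit.ite ?_ (oneBit_orFn (oneBit_eqC _ _) (oneBit_orFn (oneBit_eqC _ _) (oneBit_eqC _ _)))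
      (oneBit_orFn (oneBit_eqC _ _) (oneBit_orFn (oneBit_eqC _ _) (oneBit_eqC _ _)))
    cases flip
    · exact oneBit_eqC _ _
    · exact oneBit_notFn (oneBit_eqC _ _)
  · exact OneBit.ite (oneBit_orFn (oneBit_eqC _ _) (oneBit_orFn (oneBit_eqC _ _) (oneBit_orFn (oneBit_eqC _ _) (oneBit_eqC _ _))))
      (oneBit_notFn (oneBit_ltFn.comp _)) (oneBit_const _)

/-- The positive weight is at most one symbol long, on every input. [folklore] -/
theorem length_wpZ_le (z : List Bool) : (wpZ z).length ≤ 2 ^ 0 := by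
  obtain ⟨b, hb⟩ := oneBit_coreT false z
  rw [wpZ, iteFn_apply hb]
  cases b <;> simp

/-- The negative weight is at most one symbol long, on every input. [folklore] -/
theorem length_wnZ_le (z : List Bool) : (wnZ z).length ≤ 2 ^ 0 := by
  obtain ⟨b, hb⟩ := oneBit_coreT true z
  rw [wnZ, iteFn_apply hb]
  cases b <;> simp

end ValuesW


end AcTab

end Literature.Barriers.QuantumAdvantage

end
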